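import Literature.NumberTheory.Automorphic.ArchCoeffComplexPlaceCasimir
import Literature.NumberTheory.Automorphic.AdelicAdditiveCharacterDuality
import HarnessLib

/-!
# The trace form of `K_∞ = K ⊗ ℝ`: the standard basis, its dual, and the orthogonality of the
# extended embeddings `τ̃`

Topic `NumberTheory/Automorphic`; namespace `Literature.NumberTheory.Automorphic.MixedTraceDual`.
Definitions with bodies and theorems; no named fact, no `sorry`.

For the real trace `Tr = mixedTrace K : K_∞ → ℝ` (`x ↦ ∑_{w real} x_w + ∑_{w complex} 2 re x_w`) and
the trace form `⟨x, y⟩ = Tr(xy)` on `K_∞ = ℝ^{r₁} × ℂ^{r₂}`: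

* `e` — Mathlib's standard basis `NumberField.mixedEmbedding.stdBasis K` made explicit
  (`1_w` for `w` real; `1_w`, `i_w` for `w` complex; `stdBasis_eq_e`), and `eDual` — its
  `⟨ , ⟩`-dual family (`1_w`; `½_w`, `(-i/2)_w`): `mixedTrace_e_mul_eDual`;
* `embeddingExt_indexEquiv_*` — the extended embedding `τ̃ : K_∞ → ℂ` of `τ = indexEquiv c` on the
  basis and dual vectors;
* **`sum_embeddingExt_e_mul_eDual`** — ORTHOGONALITY OF THE EMBEDDINGS for the trace form:
  `∑_s τ̃(e_s) τ̃'(e^s) = δ_{τ,τ'}`; equivalently the complexified trace form is the split form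
  `⊕_τ` on `K_∞ ⊗ ℂ = ℂ^{Hom(K,ℂ)}`.  This is the scalar identity behind the decomposition of the
  trace-form Casimir element of `𝔤𝔩ₙ(K_∞)` along the embeddings (`ResGLnKugaCasimirScalarE`).

[cite: BorelWallach2000, I §2.3] (Casimir elements of invariant forms; the place decomposition is
folklore.)

## References

* A. Borel, N. Wallach, *Continuous cohomology, discrete subgroups, and representations of reductive
  groups*, 2nd ed. (2000), I §2.3 (held). [BorelWallach2000]
-/

noncomputable section

namespace Literature.NumberTheory.Automorphic

open scoped ComplexConjugate Classical
open Complex _root_.NumberField _root_.NumberField.InfinitePlace _root_.NumberField.mixedEmbedding Finset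

namespace MixedTraceDual

variable (K : Type) [Field K] [NumberField K]

/-! ### The standard basis and its trace-dual -/

/-- The standard basis vectors of `K_∞`: `1_w` (`w` real), `1_w` and `i_w` (`w` complex). [folklore] -/
def e : index K → mixedSpace K
  | Sum.inl w => (Pi.single w 1, 0)
  | Sum.inr ⟨w, j⟩ => (0, Pi.single w (if j = 0 then 1 else I))

/-- The trace-dual family: `1_w` (`w` real), `½_w` and `(-i/2)_w` (`w` complex). [folklore] -/
def eDual : index K → mixedSpace K
  | Sum.inl w => (Pi.single w 1, 0)
  | Sum.inr ⟨w, j⟩ => (0, Pi.single w (if j = 0 then 2⁻¹ else -(I / 2)))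

/-- Mathlib's `stdBasis K` is `e`. [folklore] -/
theorem stdBasis_eq_e : ⇑(stdBasis K) = e K := by
  funext s
  rcases s with w | ⟨w, j⟩
  · refine Prod.ext ?_ ?_
    · simp [stdBasis, e]
    · simp [stdBasis, e]
  · refine Prod.ext ?_ ?_
    · simp [stdBasis, e]
    · simp only [stdBasis, e, Module.Basis.prod_apply, Module.Basis.coe_reindex, Function.comp_apply,
        Equiv.sigmaEquivProd_symm_apply, Pi.basis_apply, coe_basisOneI, LinearMap.coe_inr, Sum.elim_inr]
      congr 1
      fin_cases j <;> simp

/-- `Tr(x · 1_w) = x_w` for `w` real. [folklore] -/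
theorem mixedTrace_mul_inl (x : mixedSpace K) (w : {w : InfinitePlace K // IsReal w}) :
    mixedTrace K (x * e K (Sum.inl w)) = x.1 w := by
  simp only [e, mixedTrace_apply, Prod.fst_mul, Prod.snd_mul, Pi.mul_apply]
  rw [Finset.sum_eq_single w (fun w' _ hw' => by simp [hw']) (fun h => absurd (mem_univ w) h)]
  simp

/-- `Tr(x · c_w) = 2 re (x_w c)` for `w` complex. [folklore] -/
theorem mixedTrace_mul_inr (x : mixedSpace K) (w : {w : InfinitePlace K // IsComplex w}) (c : ℂ) :
    mixedTrace K (x * (0, Pi.single w c)) = 2 * (x.2 w * c).re := by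
  simp only [mixedTrace_apply, Prod.fst_mul, Prod.snd_mul, Pi.mul_apply, mul_zero, sum_const_zero, zero_add,
    Pi.zero_apply]
  rw [Finset.sum_eq_single w (fun w' _ hw' => by simp [hw']) (fun h => absurd (mem_univ w) h)]
  simp

omit [NumberField K] in
/-- `e (inr (w, j)) = (0, single w c_j)`. [folklore] -/
theorem e_inr (w : {w : InfinitePlace K // IsComplex w}) (j : Fin 2) :
    e K (Sum.inr ⟨w, j⟩) = (0, Pi.single w (if j = 0 then 1 else I)) := rfl

omit [NumberField K] in
/-- `eDual (inr (w, j)) = (0, single w c'_j)`. [folklore] -/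
theorem eDual_inr (w : {w : InfinitePlace K // IsComplex w}) (j : Fin 2) :
    eDual K (Sum.inr ⟨w, j⟩) = (0, Pi.single w (if j = 0 then 2⁻¹ else -(I / 2))) := rfl

omit [NumberField K] in
/-- `eDual (inl w) = e (inl w)`. [folklore] -/
theorem eDual_inl (w : {w : InfinitePlace K // IsReal w}) : eDual K (Sum.inl w) = e K (Sum.inl w) := rfl

/-- **`eDual` is the trace-dual of `e`**: `Tr(e_s e^{s'}) = δ_{s s'}`. [folklore] -/
theorem mixedTrace_e_mul_eDual (s s' : index K) :
    mixedTrace K (e K s * eDual K s') = if s = s' then 1 else 0 := by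
  rcases s' with w' | ⟨w', j'⟩
  · rw [eDual_inl, mixedTrace_mul_inl]
    rcases s with w | ⟨w, j⟩
    · simp only [e, Pi.single_apply, Sum.inl.injEq]
      by_cases h : w = w'
      · subst h; simp
      · simp [h, Ne.symm h]
    · simp [e]
  · rw [eDual_inr, mixedTrace_mul_inr]
    rcases s with w | ⟨w, j⟩
    · simp [e]
    · simp only [e, Pi.single_apply, Sum.inr.injEq, Prod.mk.injEq]
      by_cases h : w = w'
      · subst h
        fin_cases j <;> fin_cases j' <;> simp
      · simp [h, Ne.symm h]

/-! ### The extended embeddings on the basis -/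

/-- `τ̃` for `τ = indexEquiv (inl w)` (`w` real) is evaluation at `w`. [folklore] -/
theorem embeddingExt_indexEquiv_inl (w : {w : InfinitePlace K // IsReal w}) (x : mixedSpace K) :
    embeddingExt (indexEquiv K (Sum.inl w)) x = ((x.1 w : ℝ) : ℂ) := by
  rw [indexEquiv_apply_isReal]
  have hw : (InfinitePlace.mk w.1.embedding).IsReal := by rw [mk_embedding]; exact w.2
  have hw' : (⟨InfinitePlace.mk w.1.embedding, hw⟩ : {w : InfinitePlace K // IsReal w}) = w :=
    Subtype.ext (mk_embedding w.1)
  rw [embeddingExt_of_isReal hw, evalRealAlgHom_apply, hw']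

/-- `τ̃` for `τ = indexEquiv (inr (w, 0))` (`w` complex, the chosen embedding) is evaluation at `w`.
[folklore] -/
theorem embeddingExt_indexEquiv_inr_zero (w : {w : InfinitePlace K // IsComplex w}) (x : mixedSpace K) :
    embeddingExt (indexEquiv K (Sum.inr ⟨w, 0⟩)) x = x.2 w := by
  rw [indexEquiv_apply_isComplex_fst, ComplexPlace.embeddingExt_embedding, evalComplexAlgHom_apply]

/-- `τ̃` for `τ = indexEquiv (inr (w, 1))` (the conjugate embedding) is conjugate evaluation at `w`.
[folklore] -/
theorem embeddingExt_indexEquiv_inr_one (w : {w : InfinitePlace K // IsComplex w}) (x : mixedSpace K) :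
    embeddingExt (indexEquiv K (Sum.inr ⟨w, 1⟩)) x = conj (x.2 w) := by
  rw [indexEquiv_apply_isComplex_snd, ComplexPlace.embeddingExt_conjugate_embedding]
  rfl

/-- The sign `σ(c) ∈ {1, conj}` bookkeeping: `τ̃` for `τ = indexEquiv (inr (w, j))` on `(0, single w' z)`.
[folklore] -/
theorem embeddingExt_indexEquiv_inr_single (w w' : {w : InfinitePlace K // IsComplex w}) (j : Fin 2) (z : ℂ) :
    embeddingExt (indexEquiv K (Sum.inr ⟨w, j⟩)) ((0, Pi.single w' z) : mixedSpace K) =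
      if w' = w then (if j = 0 then z else conj z) else 0 := by
  fin_cases j
  · rw [Fin.zero_eta, embeddingExt_indexEquiv_inr_zero]
    simp only [Pi.single_apply, Fin.isValue, ↓reduceIte]
    by_cases h : w' = w
    · subst h; simp
    · simp [h, Ne.symm h]
  · rw [Fin.mk_one, embeddingExt_indexEquiv_inr_one]
    simp only [Pi.single_apply, Fin.isValue, one_ne_zero, ↓reduceIte]
    by_cases h : w' = w
    · subst h; simp
    · simp [h, Ne.symm h]

/-- `τ̃` (complex `τ`) kills the real coordinates. [folklore] -/
theorem embeddingExt_indexEquiv_inr_real (w : {w : InfinitePlace K // IsComplex w}) (j : Fin 2)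
    (w' : {w : InfinitePlace K // IsReal w}) :
    embeddingExt (indexEquiv K (Sum.inr ⟨w, j⟩)) (e K (Sum.inl w')) = 0 := by
  fin_cases j
  · rw [e, Fin.zero_eta, embeddingExt_indexEquiv_inr_zero]
    rfl
  · rw [e, Fin.mk_one, embeddingExt_indexEquiv_inr_one]
    simp

/-- `τ̃` (real `τ`) kills the complex coordinates. [folklore] -/
theorem embeddingExt_indexEquiv_inl_complex (w : {w : InfinitePlace K // IsReal w})
    (w' : {w : InfinitePlace K // IsComplex w}) (z : ℂ) :
    embeddingExt (indexEquiv K (Sum.inl w)) ((0, Pi.single w' z) : mixedSpace K) = 0 := by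
  rw [embeddingExt_indexEquiv_inl]
  simp

/-- `τ̃` (real `τ` at `w`) on `1_{w'}`. [folklore] -/
theorem embeddingExt_indexEquiv_inl_inl (w w' : {w : InfinitePlace K // IsReal w}) :
    embeddingExt (indexEquiv K (Sum.inl w)) (e K (Sum.inl w')) = if w' = w then 1 else 0 := by
  rw [embeddingExt_indexEquiv_inl, e]
  simp only [Pi.single_apply]
  by_cases h : w' = w
  · subst h; simp
  · simp [Ne.symm h, h]

/-! ### Orthogonality of the embeddings -/

/-- **Orthogonality of the extended embeddings for the trace form** (indexed form):
`∑_s τ̃_c(e_s) τ̃_{c'}(e^s) = δ_{c,c'}` for `τ_c = indexEquiv c`. [cite: BorelWallach2000, I §2.3] -/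
theorem sum_embeddingExt_e_mul_eDual_index (c c' : index K) :
    ∑ s, embeddingExt (indexEquiv K c) (e K s) * embeddingExt (indexEquiv K c') (eDual K s) =
      if c = c' then 1 else 0 := by
  rw [Fintype.sum_sum_type, Fintype.sum_prod_type]
  simp only [Fin.sum_univ_two, eDual_inl, e_inr, eDual_inr, Fin.isValue, ↓reduceIte, one_ne_zero]
  rcases c with w | ⟨w, j⟩
  · -- `τ` real at `w`
    have h2 : ∀ w' : {w : InfinitePlace K // IsComplex w},
        embeddingExt (indexEquiv K (Sum.inl w)) ((0, Pi.single w' (1 : ℂ)) : mixedSpace K) *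
            embeddingExt (indexEquiv K c') ((0, Pi.single w' (2⁻¹ : ℂ)) : mixedSpace K) +
          embeddingExt (indexEquiv K (Sum.inl w)) ((0, Pi.single w' I) : mixedSpace K) *
            embeddingExt (indexEquiv K c') ((0, Pi.single w' (-(I / 2))) : mixedSpace K) = 0 := fun w' => by
      rw [embeddingExt_indexEquiv_inl_complex, embeddingExt_indexEquiv_inl_complex, zero_mul, zero_mul, add_zero]
    simp only [h2, sum_const_zero, add_zero, embeddingExt_indexEquiv_inl_inl]
    rcases c' with w' | ⟨w', j'⟩
    · simp only [embeddingExt_indexEquiv_inl_inl, Sum.inl.injEq]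
      rw [Finset.sum_eq_single w (fun v _ hv => by simp [hv]) (fun h => absurd (mem_univ w) h)]
      by_cases h : w = w'
      · subst h; simp
      · simp [h]
    · simp only [embeddingExt_indexEquiv_inr_real, mul_zero, sum_const_zero, reduceCtorEq, ↓reduceIte]
  · -- `τ` complex at `w`
    simp only [embeddingExt_indexEquiv_inr_real, zero_mul, sum_const_zero, zero_add, embeddingExt_indexEquiv_inr_single]
    rcases c' with w' | ⟨w', j'⟩
    · simp only [embeddingExt_indexEquiv_inl_complex, mul_zero, add_zero, sum_const_zero, reduceCtorEq, ↓reduceIte]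
    · simp only [embeddingExt_indexEquiv_inr_single, Sum.inr.injEq, Prod.mk.injEq]
      rw [Finset.sum_eq_single w (fun v _ hv => by simp [hv]) (fun h => absurd (mem_univ w) h)]
      simp only [↓reduceIte]
      by_cases h : w = w'
      · subst h
        simp only [↓reduceIte, true_and]
        fin_cases j <;> fin_cases j' <;> simp <;> ring_nf <;> simp [Complex.ext_iff] <;> norm_num
      · simp [h]

/-- **Orthogonality of the extended embeddings for the trace form**:
`∑_s τ̃(e_s) τ̃'(e^s) = δ_{τ,τ'}` — the complexified trace form of `K_∞` is the split form on
`ℂ^{Hom(K, ℂ)}`. [cite: BorelWallach2000, I §2.3] -/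
theorem sum_embeddingExt_e_mul_eDual (τ τ' : K →+* ℂ) :
    ∑ s, embeddingExt τ (e K s) * embeddingExt τ' (eDual K s) = if τ = τ' then 1 else 0 := by
  obtain ⟨c, rfl⟩ := (indexEquiv K).surjective τ
  obtain ⟨c', rfl⟩ := (indexEquiv K).surjective τ'
  rw [sum_embeddingExt_e_mul_eDual_index]
  by_cases h : c = c'
  · subst h; simp
  · rw [if_neg h, if_neg ((indexEquiv K).injective.ne h)]

end MixedTraceDual

end Literature.NumberTheory.Automorphic

end
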